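import Summits.BirchSwinnertonDyer.BirchSwinnertonDyer.Theorems.ByReductionTypeAtTwoOrdKatoHalfAtTwoIsoRelaxedGenuineOptimal
import Summits.BirchSwinnertonDyer.BirchSwinnertonDyer.Theorems.ByReductionTypeAtTwoOrdKatoHalfAtTwoIsoPosDiscEpsilon
import Summits.BirchSwinnertonDyer.BirchSwinnertonDyer.Theorems.AlignedTransportAtTwoMainConjectureOfRankZeroBSDAtTwoFineRoadArchRigidity
import Summits.BirchSwinnertonDyer.BirchSwinnertonDyer.Theorems.AlignedTransportAtTwoMainConjectureOfRankZeroBSDAtTwoFineRoadArchReceptacle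
import Literature.NumberTheory.EllipticCurves.IwasawaSelmerRelaxedAtInfinity
import Literature.NumberTheory.EllipticCurves.FineSelmerLimThm35AtTwoUpstairsProofs
import Literature.NumberTheory.EllipticCurves.FineSelmerUpstairsUnipotentProofs
import Summits.BirchSwinnertonDyer.BirchSwinnertonDyer.Theorems.AlignedTransportAtTwoMainConjectureOfRankZeroBSDAtTwoFineRoadLimRelUpstairs
import Summits.BirchSwinnertonDyer.BirchSwinnertonDyer.Theorems.AlignedTransportAtTwoMainConjectureOfRankZeroBSDAtTwoTorsionPointField
import Summits.BirchSwinnertonDyer.BirchSwinnertonDyer.Theorems.ByReductionTypeAtTwoOrdKatoHalfAtTwoIsoPosDiscEpsilonDefs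
import HarnessLib

/-!
# Cert45c (GEN 45) — INLINE TWIN of `Cert45b.lean` while the hub olean of the tree module
# `Summits.BirchSwinnertonDyer.BirchSwinnertonDyer.Theorems.ByReductionTypeAtTwoOrdKatoHalfAtTwoIsoConjATwoOfPointFieldMu` (p718233, tree
# mtime 2026-08-29T12:15:46Z, sha256-16 3ba98158022d9319) is not yet built (`lean check Cert45b.lean` → rc 75 «unbuilt» at 12:25Z and 12:32Z):
# PART 1 below is that tree file's text VERBATIM after its import lines, with ONLY its namespace renamed `…SteinbergFibreAtTwo.PointFieldMu` →
# `…SteinbergFibreAtTwo.PointFieldMuInline45` (so that this scratch copy can never collide with the real module); PART 2 is `Cert45b.lean` verbatim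
# after its import lines (namespace `…Cert45c`, `open …PointFieldMuInline45`). All imports of both parts are hub-built (probe `ProbeUnip.lean` rc 0,
# 12:32Z). Refuter-grade certificate of crux-triage r1 seat 2 (stmt-BirchSwinnertonDyer-19573); CONDITIONAL; nothing asserted; nothing here is
# a tree theorem of mine — PART 1's theorems are w2 GEN 6's, re-elaborated; the crux, Q⁺, Iw⁺, Iw₆⁺ remain OPEN; BSD is not proved.
-/

-- ============================== PART 1: tree text of p718233 (namespace renamed) ==============================
/-!
# Route `ByReductionTypeAtTwo` (K4), crux 202 `OrdKatoHalfAtTwoIso` (stmt-BirchSwinnertonDyer-19573), line `steinberg-fibre-at-two`,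
# registered research stub Q⁺ `FineSelmerConjATwoOrdPosDisc`: its two displayed classical-`μ` supply roads WITHOUT the Lim@2 print
# binder — Q⁺ ⟸ Iw⁺ (carrier `ℚ(W[2], √−1)`) and Q⁺ ⟸ `μ₂ = 0` on the SMALL carrier `ℚ(P, √−1)` — both KERNEL doors now
Seat `cruxlead-stmt-BirchSwinnertonDyer-19573-w2` GEN 6 (prover WIDTH under the LEAD lineage; HOME `run/shared/lean/pub/bsd-2adic/`;
`--supports stmt-BirchSwinnertonDyer-19573`). HONEST FRAMING (cell bsd-2adic): THEOREMS ONLY — no definition, no named fact, no `sorry`;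
the crux, its PAIR child 24097 and Q⁺ are NOT proved here; Q⁺ (Coates–Sujatha's Conjecture A at `2` on the cell) stays an OPEN `∀`-statement
whose input below is Iwasawa's classical `μ₂ = 0` on a NON-ABELIAN family (open); BSD is not proved by any of this.
WHY. Skeleton v19's displayed supply roads for Q⁺ — `conjA_two_posDisc_of_lim_of_classicalMu` (Iw⁺, carrier `ℚ(W[2], √−1)`) and
`conjA_two_posDisc_of_lim_of_classicalMu_pointField` (carrier the sextic `ℚ(P, √−1)`) — were BOTH conditional on the PRINT binder `hLim2`
(Lim 2017 Thm. 3.5 at `2`, downstairs `L`-form; at these carriers its printed proof uses Iwasawa's 1973 ascent). This gen made the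
UPSTAIRS form a tree theorem (`Lim2017.thm35_at_two_upstairs_fineSelmer_twoTorsion_finite_of_classicalMuVanishes_holds`, p716773) and typed
the unipotent variant over a totally complex base (`FineSelmerUpstairs.finite_primewiseFine_pTorsion_galImage_of_unipotent`, p717389, no ascent).
This file cashes both in:

* §1 (any number field `K`, any `p`) **`finite_pTorsion_fineRelaxed_of_primewise_upstairs`** — Lim's Lemma 3.2 descent for a NOT
  NECESSARILY NORMAL upstairs group `Ω` (`N ≤ Ω ≤ ker κ`, `N` normal of finite index in `ker κ`): if the classes of `H¹(Ω, E[p^∞])`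
  killed by `p` and dying on every `Ω ⊓ D_𝔓` are finite, then `Sel₀^{rel ∞}(K_∞, E[p^∞])[p]` is finite — the cell bsd-f1-sign2 kernel
  (`LimDescent.finite_pTorsion_of_resOfLe_maps`, generic) with the `p`-torsion kernel of the restriction bounded through the NORMAL CORE `N`
  (`LimDescent.finite_pTorsion_ker_resOfLe`), the relaxed fine classes restricting prime-wise
  (`FineSelmerUpstairs.resOfLe_decompositionSubgroup_eq_zero_of_forall_decomp`).
* §2 (any number field `K`, `p = 2`, `P ∈ E[2] ∖ 0`, `i² = −1`, carrier `F = K(P) ⊔ K⟮i⟯ = K̄^{Stab P} ⊔ K⟮i⟯`)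
  `exists_smul_twoTorsion_fixed_by_resGal` — `res(Γ_F)` fixes a CONJUGATE `σ₀ • P` (the restriction `Γ_F → Γ_K` is defined through a chosen
  embedding, `exists_mem_range_absGaloisRestrict_iff`; `Stab P` is open, `fixingSubgroup_fixedField_of_isOpen`), whence the unipotent flag
  `ℤ·(σ₀ • P) ⊂ E[2]` (`AlignedTransportAtTwoTorsionPointField.smul_sub_mem_zmultiples_of_smul_eq`); and
  **`exists_fineSelmerDualData_moduleFinite_of_classicalMu_pointField_adjoin`**: Iwasawa's `μ₂ = 0` for the cyclotomic `ℤ₂`-extensions of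
  `F` ⟹ statement (A) at `(E, 2)` DOWNSTAIRS over `K_∞` in the `∃ γ D` form (upstairs prime-wise finiteness over `galImage(ker κ_F)`; §1 with
  `N = ker ρ̄_{E,2} ⊓ ker χ₂`; `LimRelUpstairs.finite_pTorsion_fineSelmer_of_relaxed`; `exists_fineSelmerDualData_moduleFinite_iff_finite_pTorsion`).
* §3 (`K = ℚ`, the cell) the two doors BY NAME of the route's texts (p699544 `…PosDiscEpsilonDefs`):
  **`fineSelmerConjATwoOrdPosDisc_of_classicalMuTwo : ClassicalMuTwoDivisionFieldAdjoinIOrdPosDisc → FineSelmerConjATwoOrdPosDisc`** (Q⁺ ⟸ Iw⁺,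
  via `LimRelUpstairs.exists_fineSelmerDualData_moduleFinite_of_lim2017 …_holds`) and
  **`fineSelmerConjATwoOrdPosDisc_of_classicalMu_pointField_adjoin_I`** (Q⁺ ⟸ «∀ cell `W` ∃ `P ≠ 0`, `i`: `μ₂ = 0` along the cyclotomic
  `ℤ₂`-extensions of `ℚ(P, i)`» — the lead's `conjA_two_posDisc_of_lim_of_classicalMu_pointField` hypothesis VERBATIM, minus `hLim2`).

References: [Lim2017FineSelmer] §3 Lemma 3.2, Thm. 3.5; [CoatesSujatha2005] Conj. A, §3 Thm. 3.4, Lemma 3.3; [Iwasawa1973MuInvariants] §1;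
[SerreGaloisCohomology1997] I §2.6; [SilvermanAEC2009] III.6.4, VIII.§1; [MilneFT2022] Ch. 7; tree p699544, p706268, p716255, p716773, p717389.
-/

set_option autoImplicit false
-- the Theorems namespace of this sub repeats the summit name by design (D-0017 nested layout)
set_option linter.dupNamespace false

noncomputable section

open scoped Classical

namespace Summit.BirchSwinnertonDyer.BirchSwinnertonDyer.Theorems.SteinbergFibreAtTwo.PointFieldMuInline45

open WeierstrassCurve NumberField IsDedekindDomain Field
open Literature.NumberTheory.EllipticCurves Literature.NumberTheory.EllipticCurves.GreenbergSelmer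
  Literature.NumberTheory.GaloisRepresentations Literature.NumberTheory.IwasawaTheory
  Literature.NumberTheory.EllipticCurves.Rank1Residual
open Summit.BirchSwinnertonDyer.BirchSwinnertonDyer.Theorems.AlignedTransportAtTwoFineRoad
open Summit.BirchSwinnertonDyer.BirchSwinnertonDyer.Theorems.AlignedTransportAtTwoTorsionPointField

/-! ## §1 Lim's Lemma 3.2 descent for a not necessarily normal upstairs group, prime-wise form -/

section Descent

variable {K : Type} [Field K] [NumberField K] (W : WeierstrassCurve K) [W.IsElliptic] (p : ℕ) [Fact p.Prime]
  (κ : ZpExtension K p)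

/-- **DESCENT (Lim 2017, Lemma 3.2) for a not necessarily normal upstairs group.** `κ` a `ℤ_p`-extension of the number field `K`,
`N ≤ Ω ≤ ker κ` subgroups of `Γ_K` with `N` NORMAL in `Γ_K` and of finite index in `ker κ` (`Ω` itself need not be normal — e.g.
`Ω = Gal(K̄/K(P)·K_∞)` for a `2`-torsion point `P`, `N = Gal(K̄/K(E[2], μ_{2^∞}))`). If the classes of `H¹(Ω, E[p^∞])` killed by `p` that
restrict to zero on `Ω ⊓ D_𝔓` for every maximal ideal `𝔓 ⊂ \bar ℤ_K` form a finite set, then `Sel₀^{rel ∞}(K_∞, E[p^∞])[p]` is finite: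
the `p`-torsion kernel of `res : H¹(ker κ) → H¹(Ω)` lies in that of `res : H¹(ker κ) → H¹(N)`, finite by `p`-torsion inflation–restriction
at the NORMAL `N` (`LimDescent.finite_pTorsion_ker_resOfLe`); relaxed fine classes restrict to prime-wise fine classes
(`FineSelmerUpstairs.resOfLe_decompositionSubgroup_eq_zero_of_forall_decomp`); fibre counting (`LimDescent.finite_pTorsion_of_resOfLe_maps`).
[cite: Lim2017FineSelmer, §3 Lemma 3.2 (arXiv:1306.2047 p. 6)] [cite: SerreGaloisCohomology1997, I §2.6 (inflation–restriction)] -/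
theorem finite_pTorsion_fineRelaxed_of_primewise_upstairs
    {Ω N : Subgroup (absoluteGaloisGroup K)} [N.Normal] (hNΩ : N ≤ Ω) (hΩ : Ω ≤ κ.kerSubgroup)
    (hind : (N.subgroupOf κ.kerSubgroup).FiniteIndex)
    (hup : Set.Finite {c : W.subgroupH1 p Ω |
      (∀ 𝔓 : Ideal (absIntegers (𝓞 K) K), 𝔓.IsMaximal →
        W.resOfLe p (inf_le_left : Ω ⊓ 𝔓.decompositionSubgroup (absoluteGaloisGroup K) ≤ Ω) c = 0) ∧ p • c = 0}) :
    Set.Finite {s : W.fineSelmerInftyRelaxedInf κ | p • s = 0} := by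
  -- the `p`-torsion kernel of `res : H¹(ker κ) → H¹(Ω)`, bounded through `N`
  have hkerN : Set.Finite {c : W.subgroupH1 p κ.kerSubgroup | p • c = 0 ∧ W.resOfLe p (hNΩ.trans hΩ) c = 0} :=
    LimDescent.finite_pTorsion_ker_resOfLe (M := W.geomPrimaryTorsion p) (hNΩ.trans hΩ)
      (fun g _ x hx ↦ by simpa [mul_assoc] using (inferInstance : N.Normal).conj_mem x hx g⁻¹) hind
      (fun m ↦ W.continuous_smul_geomPrimaryTorsion p m) p
      (LimDescent.finite_modN_fixedPoints_geomPrimaryTorsion W p N) (LimDescent.finite_pTorsion_geomPrimaryTorsion W p)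
  have hker : Set.Finite {c : W.subgroupH1 p κ.kerSubgroup | p • c = 0 ∧ W.resOfLe p hΩ c = 0} := by
    refine hkerN.subset ?_
    rintro c ⟨hpc, hc⟩
    refine ⟨hpc, ?_⟩
    have e := congrArg (fun f ↦ f c) (W.resOfLe_comp_holds p hNΩ hΩ)
    simp only [AddMonoidHom.comp_apply] at e
    rw [← e, hc, map_zero]
  -- the prime-wise fine classes over `Ω`
  let S₂ : AddSubgroup (W.subgroupH1 p Ω) :=
    { carrier := {c | ∀ 𝔓 : Ideal (absIntegers (𝓞 K) K), 𝔓.IsMaximal →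
        W.resOfLe p (inf_le_left : Ω ⊓ 𝔓.decompositionSubgroup (absoluteGaloisGroup K) ≤ Ω) c = 0}
      add_mem' := fun {a b} ha hb 𝔓 h𝔓 ↦ by rw [map_add, ha 𝔓 h𝔓, hb 𝔓 h𝔓, add_zero]
      zero_mem' := fun 𝔓 _ ↦ map_zero _
      neg_mem' := fun {a} ha 𝔓 h𝔓 ↦ by rw [map_neg, ha 𝔓 h𝔓, neg_zero] }
  have hmap : ∀ c ∈ W.fineSelmerInftyRelaxedInf κ, W.resOfLe p hΩ c ∈ S₂ := by
    intro c hc 𝔓 h𝔓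
    have hc' := (mem_strictSelmerGroupOverRelaxedInf_iff (H := κ.kerSubgroup) (M := W.geomPrimaryTorsion p)
      (L := fineData (W.geomPrimaryTorsion p) p) c).1 hc
    have hloc : ∀ (v : HeightOneSpectrum (𝓞 K)) (σ : absoluteGaloisGroup K),
        resOfLe (W.geomPrimaryTorsion p) (inf_le_left : κ.kerSubgroup ⊓ decomp v ≤ κ.kerSubgroup)
          (W.conjH1 p κ.kerSubgroup σ c) = 0 := by
      intro v σ
      by_cases hv : ((p : ℕ) : 𝓞 K) ∈ v.asIdeal
      · exact (FineSelmerCoefficientMap.mem_strictKer_fineLocalDatum_iff _ v _).1 (hc'.2 v hv σ)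
      · exact hc'.1 v hv σ
    have h0 : W.resOfLe p (inf_le_left :
        κ.kerSubgroup ⊓ 𝔓.decompositionSubgroup (absoluteGaloisGroup K) ≤ κ.kerSubgroup) c = 0 :=
      FineSelmerUpstairs.resOfLe_decompositionSubgroup_eq_zero_of_forall_decomp κ.kerSubgroup hloc 𝔓
    have hle1 : Ω ⊓ 𝔓.decompositionSubgroup (absoluteGaloisGroup K) ≤
        κ.kerSubgroup ⊓ 𝔓.decompositionSubgroup (absoluteGaloisGroup K) := inf_le_inf_right _ hΩ
    have e1 := congrArg (fun f ↦ f c)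
      (W.resOfLe_comp_holds p (inf_le_left : Ω ⊓ 𝔓.decompositionSubgroup (absoluteGaloisGroup K) ≤ Ω) hΩ)
    have e2 := congrArg (fun f ↦ f c) (W.resOfLe_comp_holds p hle1
      (inf_le_left : κ.kerSubgroup ⊓ 𝔓.decompositionSubgroup (absoluteGaloisGroup K) ≤ κ.kerSubgroup))
    simp only [AddMonoidHom.comp_apply] at e1 e2
    rw [e1, ← e2, h0, map_zero]
  have hmain := LimDescent.finite_pTorsion_of_resOfLe_maps (M := W.geomPrimaryTorsion p) hΩ p
    (W.fineSelmerInftyRelaxedInf κ) S₂ hmap hup hker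
  refine Set.Finite.of_finite_image (hmain.subset ?_) Subtype.coe_injective.injOn
  rintro _ ⟨s, hs, rfl⟩
  refine ⟨s.2, ?_⟩
  have hs' : p • s = 0 := hs
  rw [← AddSubmonoidClass.coe_nsmul, hs', ZeroMemClass.coe_zero]

end Descent

/-! ## §2 The small carrier `F = K(P) ⊔ K⟮i⟯`: statement (A) at `(E, 2)` downstairs from `μ₂(F^{cyc}) = 0` -/

section PointField

variable {K : Type} [Field K] [NumberField K] (W : WeierstrassCurve K) [W.IsElliptic]

omit [NumberField K] [W.IsElliptic] in
/-- The stabiliser of a torsion point (for the action on `E[n]`) is the stabiliser of the underlying geometric point, hence OPEN.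
[cite: SilvermanAEC2009, VIII.§1 (action of G_{K̄/K} on E[m])] -/
theorem isOpen_stabilizer_geomTorsion {n : ℤ} (P : geomTorsion W n) :
    IsOpen ((MulAction.stabilizer (absoluteGaloisGroup K) P : Subgroup (absoluteGaloisGroup K)) :
      Set (absoluteGaloisGroup K)) := by
  have h : (MulAction.stabilizer (absoluteGaloisGroup K) P : Subgroup (absoluteGaloisGroup K)) =
      MulAction.stabilizer (absoluteGaloisGroup K) (P : geomPoints W) := by
    ext σ
    simp only [MulAction.mem_stabilizer_iff]
    rw [Subtype.ext_iff, AddSubgroup.torsionBy.coe_smul]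
  rw [h]
  exact W.isOpen_stabilizer_point_holds (P : geomPoints W)

omit [W.IsElliptic] in
/-- **`res(Γ_F)` fixes a CONJUGATE of `P`, for the carrier `F = K̄^{Stab P} ⊔ K⟮i⟯`.** The restriction `res : Γ_F → Γ_K` is defined through
a chosen embedding, so `res(Γ_F) = Gal(K̄/e(F))` for SOME `K`-embedding `e : F → K̄` (`exists_mem_range_absGaloisRestrict_iff`); extending `e`
to `σ₀ ∈ Γ_K` (`AlgHom.liftNormal`), every `g ∈ res(Γ_F)` has `σ₀⁻¹ g σ₀` fixing `K̄^{Stab P}` pointwise, i.e. lying in `Stab P` (Galois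
correspondence for the OPEN subgroup `Stab P`, `fixingSubgroup_fixedField_of_isOpen`), i.e. `g` fixes `σ₀ • P`. (For `K(P)/K` normal one may
take `σ₀ = 1`; on the `S₃` cell `K(P)` is a non-Galois cubic.) [cite: MilneFT2022, Ch. 7 (restriction to a subfield; the Galois correspondence)]
[cite: SilvermanAEC2009, VIII.§1] -/
theorem exists_smul_twoTorsion_fixed_by_resGal (P : geomTorsion W 2) (i : AlgebraicClosure K) :
    ∃ σ₀ : absoluteGaloisGroup K, ∀ τ : absoluteGaloisGroup
        ↥(IntermediateField.fixedField (MulAction.stabilizer (absoluteGaloisGroup K) P) ⊔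
          IntermediateField.adjoin K ({i} : Set (AlgebraicClosure K))),
      resGal (K := K) ↥(IntermediateField.fixedField (MulAction.stabilizer (absoluteGaloisGroup K) P) ⊔
          IntermediateField.adjoin K ({i} : Set (AlgebraicClosure K))) τ • (σ₀ • P) = σ₀ • P := by
  haveI : Algebra.IsAlgebraic K ↥(IntermediateField.fixedField (MulAction.stabilizer (absoluteGaloisGroup K) P) ⊔
      IntermediateField.adjoin K ({i} : Set (AlgebraicClosure K))) := inferInstance
  obtain ⟨e, he⟩ := exists_mem_range_absGaloisRestrict_iff K
    ↥(IntermediateField.fixedField (MulAction.stabilizer (absoluteGaloisGroup K) P) ⊔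
      IntermediateField.adjoin K ({i} : Set (AlgebraicClosure K)))
  -- extend `e` to an automorphism `σ₀` of `K̄`
  let eL : AlgebraicClosure K →ₐ[K] AlgebraicClosure K := e.liftNormal (AlgebraicClosure K)
  have heL : ∀ x : ↥(IntermediateField.fixedField (MulAction.stabilizer (absoluteGaloisGroup K) P) ⊔
      IntermediateField.adjoin K ({i} : Set (AlgebraicClosure K))), eL (x : AlgebraicClosure K) = e x := fun x ↦ by
    have h := e.liftNormal_commutes (AlgebraicClosure K) x
    simpa using h
  let σ₀' : AlgebraicClosure K ≃ₐ[K] AlgebraicClosure K :=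
    AlgEquiv.ofBijective eL (Algebra.IsAlgebraic.algHom_bijective eL)
  have hσ₀' : ∀ x, σ₀' x = eL x := fun _ ↦ rfl
  let σ₀ : absoluteGaloisGroup K := (absoluteGaloisGroup.toAlgEquiv K).symm σ₀'
  have hσ₀ : absoluteGaloisGroup.toAlgEquiv K σ₀ = σ₀' := (absoluteGaloisGroup.toAlgEquiv K).apply_symm_apply σ₀'
  refine ⟨σ₀, fun τ ↦ ?_⟩
  have hfix := (he (resGal (K := K) _ τ)).1 ⟨τ, rfl⟩
  -- `σ₀⁻¹ · res τ · σ₀` fixes `K̄^{Stab P}` pointwise, hence stabilises `P`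
  have hfixpt : ∀ x ∈ IntermediateField.fixedField (MulAction.stabilizer (absoluteGaloisGroup K) P),
      (σ₀⁻¹ * resGal (K := K) _ τ * σ₀) • x = x := by
    intro x hx
    have hxF : x ∈ IntermediateField.fixedField (MulAction.stabilizer (absoluteGaloisGroup K) P) ⊔
        IntermediateField.adjoin K ({i} : Set (AlgebraicClosure K)) :=
      (le_sup_left (a := IntermediateField.fixedField (MulAction.stabilizer (absoluteGaloisGroup K) P))
        (b := IntermediateField.adjoin K ({i} : Set (AlgebraicClosure K)))) hx
    have h1 : resGal (K := K) _ τ • e ⟨x, hxF⟩ = e ⟨x, hxF⟩ := hfix ⟨x, hxF⟩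
    have h2 : σ₀ • x = (e ⟨x, hxF⟩ : AlgebraicClosure K) := by
      rw [absoluteGaloisGroup.smul_def, hσ₀, hσ₀']
      exact heL ⟨x, hxF⟩
    rw [mul_smul, mul_smul, h2, h1, ← h2, inv_smul_smul]
  have hstab : σ₀⁻¹ * resGal (K := K) _ τ * σ₀ ∈ MulAction.stabilizer (absoluteGaloisGroup K) P := by
    have hfs := fixingSubgroup_fixedField_of_isOpen (MulAction.stabilizer (absoluteGaloisGroup K) P)
      (isOpen_stabilizer_geomTorsion W P)
    rw [SetLike.ext_iff] at hfs
    refine (hfs _).1 ?_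
    refine (IntermediateField.mem_fixingSubgroup_iff _
      (absoluteGaloisGroup.toAlgEquiv K (σ₀⁻¹ * resGal (K := K) _ τ * σ₀))).2 fun x hx ↦ ?_
    rw [← absoluteGaloisGroup.smul_def]
    exact hfixpt x hx
  rw [MulAction.mem_stabilizer_iff, mul_smul, mul_smul, inv_smul_eq_iff] at hstab
  exact hstab

omit [NumberField K] in
/-- `ker ρ̄_{E,2} ⊓ ker χ₂` has finite index in `ker κ` for a cyclotomic `κ` (any number field; the `ℚ` case is
`LimRelUpstairs.finiteIndex_upstairs_subgroupOf`). [cite: Washington1997, §13.1] [cite: SilvermanAEC2009, VIII.§1] -/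
theorem finiteIndex_upstairs_subgroupOf' (κ : ZpExtension K 2) (hκ : κ.IsCyclotomic) :
    (((W.galoisRepTorsion 2).ker ⊓ (GaloisRep.cyclotomicCharacter K 2).toMonoidHom.ker).subgroupOf
      κ.kerSubgroup).FiniteIndex := by
  haveI := LimRelUpstairs.finiteIndex_ker_galoisRepTorsion W (n := 2) two_ne_zero
  haveI := InfRes.finiteIndex_ker_cyclotomicCharacter κ hκ
  have h : ((W.galoisRepTorsion 2).ker ⊓ (GaloisRep.cyclotomicCharacter K 2).toMonoidHom.ker).subgroupOf
      κ.kerSubgroup = ((W.galoisRepTorsion 2).ker).subgroupOf κ.kerSubgroup ⊓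
        ((GaloisRep.cyclotomicCharacter K 2).toMonoidHom.ker).subgroupOf κ.kerSubgroup := by
    ext x
    simp only [Subgroup.mem_subgroupOf, Subgroup.mem_inf]
  have e : (W.galoisRepTorsion ((2 : ℕ) : ℤ)).ker = (W.galoisRepTorsion 2).ker := rfl
  rw [e] at *
  rw [h]
  infer_instance

/-- **Statement (A) at `(E, 2)` DOWNSTAIRS from Iwasawa's `μ₂ = 0` on the SMALL carrier `F = K(P) ⊔ K⟮i⟯`** (`E = W/K` elliptic over a number
field, `P ∈ E[2] ∖ 0`, `i² = −1`; `F = K̄^{Stab P} ⊔ K⟮i⟯` is totally complex and `res(Γ_F)` acts on `E[2]` unipotently with flag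
`ℤ·(σ₀ • P)`): if every cyclotomic `ℤ₂`-extension of `F` has classical `μ = 0`, then for every cyclotomic `ℤ₂`-extension `κ` of `K` some
fine Selmer dual datum of `E` over `K_∞` is finitely generated over `ℤ₂` (`∃ γ D` form). Chain: upstairs prime-wise finiteness over
`galImage(ker κ_F)` (`FineSelmerUpstairs.finite_primewiseFine_pTorsion_galImage_of_unipotent`) → §1 with `N = ker ρ̄_{E,2} ⊓ ker χ₂ ≤ galImage(ker κ_F)`
(an element fixing `E[2]` and `μ_{2^∞}` fixes `e(F) ⊆ K(E[2], i)` and has `χ₂ = 1 ∈ μ(ℤ₂)`) → `Sel₀^{rel ∞}[2]` finite → `Sel₀[2]` finite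
(`LimRelUpstairs.finite_pTorsion_fineSelmer_of_relaxed`) → `∃ γ D` (`exists_fineSelmerDualData_moduleFinite_iff_finite_pTorsion`). NO Lim@2
named fact, NO Iwasawa ascent. [cite: Lim2017FineSelmer, §3 Thm. 3.5 (hypothesis on L) and Lemma 3.2] [cite: CoatesSujatha2005, statement (A), Thm. 3.4]
[cite: Iwasawa1973MuInvariants, §1 (the input; Thm. 2/3 not used)] -/
theorem exists_fineSelmerDualData_moduleFinite_of_classicalMu_pointField_adjoin {P : geomTorsion W 2} (hP : P ≠ 0)
    {i : AlgebraicClosure K} (hi : i ^ 2 = -1)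
    (hμ : ∀ κF : ZpExtension ↥(IntermediateField.fixedField (MulAction.stabilizer (absoluteGaloisGroup K) P) ⊔
        IntermediateField.adjoin K ({i} : Set (AlgebraicClosure K))) 2, κF.IsCyclotomic → ClassicalMuVanishes κF)
    (κ : ZpExtension K 2) (hκ : κ.IsCyclotomic) :
    ∃ (γ : absoluteGaloisGroup K) (D : W.FineSelmerDualData κ γ),
      Module.Finite ℤ_[2] (RestrictScalars ℤ_[2] (IwasawaAlgebra 2) D.X) := by
  haveI : Fact (Nat.Prime 2) := ⟨Nat.prime_two⟩
  haveI : NeZero ((2 : ℕ) : K) := ⟨by exact_mod_cast (two_ne_zero : (2 : K) ≠ 0)⟩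
  -- the carrier `F`: a totally complex number field
  have hint : IsIntegral K i := by
    refine ⟨Polynomial.X ^ 2 + 1, Polynomial.monic_X_pow_add_C _ two_ne_zero, ?_⟩
    simp [hi]
  haveI := IntermediateField.adjoin.finiteDimensional hint
  haveI := finiteDimensional_fixedField_stabilizer W P
  haveI : NumberField ↥(IntermediateField.fixedField (MulAction.stabilizer (absoluteGaloisGroup K) P) ⊔
      IntermediateField.adjoin K ({i} : Set (AlgebraicClosure K))) := NumberField.of_module_finite K _
  have hFc : ∀ w : InfinitePlace ↥(IntermediateField.fixedField (MulAction.stabilizer (absoluteGaloisGroup K) P) ⊔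
      IntermediateField.adjoin K ({i} : Set (AlgebraicClosure K))), w.IsComplex :=
    FineSelmerUpstairs.isComplex_of_mem_sq_eq_neg_one i hi _
      ((le_sup_right : IntermediateField.adjoin K ({i} : Set (AlgebraicClosure K)) ≤ _)
        (IntermediateField.mem_adjoin_simple_self K i))
  -- a cyclotomic `ℤ₂`-extension of `F`
  obtain ⟨κF, hκF⟩ := ZpExtension.exists_isCyclotomic_holds
    (↥(IntermediateField.fixedField (MulAction.stabilizer (absoluteGaloisGroup K) P) ⊔
      IntermediateField.adjoin K ({i} : Set (AlgebraicClosure K)))) 2 (GaloisRep.cyclotomicCharacter_range_infinite _ 2)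
  -- the unipotent flag `ℤ·(σ₀ • P)`
  obtain ⟨σ₀, hσ₀⟩ := exists_smul_twoTorsion_fixed_by_resGal W P i
  have hP' : σ₀ • P ≠ 0 := fun h ↦ hP (by rw [← inv_smul_smul σ₀ P, h, smul_zero])
  set C : AddSubgroup (geomTorsion W ((2 : ℕ) : ℤ)) := AddSubgroup.zmultiples (σ₀ • P) with hC
  have hC1 : ∀ (τ : absoluteGaloisGroup ↥(IntermediateField.fixedField (MulAction.stabilizer (absoluteGaloisGroup K) P) ⊔
      IntermediateField.adjoin K ({i} : Set (AlgebraicClosure K)))) (Q : geomTorsion W ((2 : ℕ) : ℤ)),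
      Q ∈ C → resGal (K := K) _ τ • Q = Q := by
    intro τ Q hQ
    obtain ⟨k, rfl⟩ := AddSubgroup.mem_zmultiples_iff.mp hQ
    rw [show resGal (K := K) _ τ • (k • (σ₀ • P)) = k • (resGal (K := K) _ τ • (σ₀ • P)) from
      map_zsmul (DistribSMul.toAddMonoidHom (geomTorsion W ((2 : ℕ) : ℤ)) (resGal (K := K) _ τ)) k (σ₀ • P), hσ₀ τ]
  have hC2 : ∀ (τ : absoluteGaloisGroup ↥(IntermediateField.fixedField (MulAction.stabilizer (absoluteGaloisGroup K) P) ⊔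
      IntermediateField.adjoin K ({i} : Set (AlgebraicClosure K)))) (Q : geomTorsion W ((2 : ℕ) : ℤ)),
      resGal (K := K) _ τ • Q - Q ∈ C :=
    fun τ Q ↦ smul_sub_mem_zmultiples_of_smul_eq hP' (hσ₀ τ) Q
  -- upstairs, prime-wise, over `Ω = galImage(ker κ_F)`
  have hup := FineSelmerUpstairs.finite_primewiseFine_pTorsion_galImage_of_unipotent W hFc C hC1 hC2 κF hκF (hμ κF hκF)
  -- `N = ker ρ̄_{E,2} ⊓ ker χ₂ ≤ Ω ≤ ker κ`
  have hkerF := FineSelmerFiniteOfUnramifiedClasses.kerSubgroup_eq_comap_of_isCyclotomic κ hκ κF hκF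
  have hΩ : BaseChangeModel.galImage K _ κF.kerSubgroup ≤ κ.kerSubgroup := by
    unfold BaseChangeModel.galImage
    rw [resGal_eq_absGaloisRestrict, hkerF]
    exact Subgroup.map_comap_le _ _
  obtain ⟨e, he⟩ := exists_mem_range_absGaloisRestrict_iff K
    ↥(IntermediateField.fixedField (MulAction.stabilizer (absoluteGaloisGroup K) P) ⊔
      IntermediateField.adjoin K ({i} : Set (AlgebraicClosure K)))
  have hNΩ : (W.galoisRepTorsion 2).ker ⊓ (GaloisRep.cyclotomicCharacter K 2).toMonoidHom.ker ≤
      BaseChangeModel.galImage K _ κF.kerSubgroup := by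
    intro g hg
    obtain ⟨hρ, hχ⟩ := Subgroup.mem_inf.1 hg
    rw [MonoidHom.mem_ker] at hρ hχ
    change GaloisRep.cyclotomicCharacter K 2 g = 1 at hχ
    have hρ' : ∀ T : geomTorsion W ((2 : ℕ) : ℤ), g • T = T := fun T ↦ by
      rw [← galoisRepTorsion_apply]
      have e2 : W.galoisRepTorsion ((2 : ℕ) : ℤ) g = 1 := hρ
      rw [e2]
      rfl
    -- `g` (and every Γ_K-conjugate of it) fixes `F` pointwise: it stabilises every `2`-torsion point and fixes `i`
    have hfixF : ∀ (ρ : absoluteGaloisGroup K) (x : AlgebraicClosure K),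
        x ∈ IntermediateField.fixedField (MulAction.stabilizer (absoluteGaloisGroup K) P) ⊔
          IntermediateField.adjoin K ({i} : Set (AlgebraicClosure K)) → (ρ⁻¹ * g * ρ) • x = x := by
      intro ρ x hx
      have hmem : absoluteGaloisGroup.toAlgEquiv K (ρ⁻¹ * g * ρ) ∈
          (IntermediateField.fixedField (MulAction.stabilizer (absoluteGaloisGroup K) P) ⊔
            IntermediateField.adjoin K ({i} : Set (AlgebraicClosure K))).fixingSubgroup := by
        rw [IntermediateField.fixingSubgroup_sup]
        refine ⟨?_, ?_⟩
        · -- `ρ⁻¹ g ρ ∈ Stab P ≤ fixingSubgroup (fixedField (Stab P))`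
          have hst : ρ⁻¹ * g * ρ ∈ MulAction.stabilizer (absoluteGaloisGroup K) P := by
            rw [MulAction.mem_stabilizer_iff, mul_smul, mul_smul, hρ' (ρ • P), inv_smul_smul]
          exact (IntermediateField.le_iff_le _ _).1 le_rfl hst
        · refine (FineSelmerUpstairs.mem_fixingSubgroup_adjoin_simple_iff i _).2 ?_
          rw [← absoluteGaloisGroup.smul_def]
          apply FineSelmerUpstairs.smul_eq_self_of_cyclotomicCharacter_eq_one i hi
          rw [map_mul, map_mul, hχ, mul_one, ← map_mul, inv_mul_cancel, map_one]
      rw [absoluteGaloisGroup.smul_def]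
      exact (IntermediateField.mem_fixingSubgroup_iff _ _).1 hmem x hx
    -- hence `g` fixes `e(F)`: `e` extends to some `σ ∈ Γ_K` with `e y = σ • y`
    have hrange : g ∈ (absGaloisRestrict K ↥(IntermediateField.fixedField (MulAction.stabilizer (absoluteGaloisGroup K) P) ⊔
        IntermediateField.adjoin K ({i} : Set (AlgebraicClosure K)))).range := by
      refine (he g).2 fun y ↦ ?_
      let eL : AlgebraicClosure K →ₐ[K] AlgebraicClosure K := e.liftNormal (AlgebraicClosure K)
      have heL : eL (y : AlgebraicClosure K) = e y := by
        have h := e.liftNormal_commutes (AlgebraicClosure K) y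
        simpa using h
      let σ' : AlgebraicClosure K ≃ₐ[K] AlgebraicClosure K :=
        AlgEquiv.ofBijective eL (Algebra.IsAlgebraic.algHom_bijective eL)
      set σ : absoluteGaloisGroup K := (absoluteGaloisGroup.toAlgEquiv K).symm σ' with hσdef
      have hσ : absoluteGaloisGroup.toAlgEquiv K σ = σ' := (absoluteGaloisGroup.toAlgEquiv K).apply_symm_apply σ'
      have hey : (e y : AlgebraicClosure K) = σ • (y : AlgebraicClosure K) := by
        rw [absoluteGaloisGroup.smul_def, hσ]
        exact heL.symm
      rw [hey, show g • σ • (y : AlgebraicClosure K) = σ • ((σ⁻¹ * g * σ) • (y : AlgebraicClosure K)) by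
        rw [mul_smul, mul_smul, smul_inv_smul], hfixF σ y y.2]
    unfold BaseChangeModel.galImage
    rw [resGal_eq_absGaloisRestrict, hkerF]
    change g ∈ Subgroup.map (absGaloisRestrict K _).toMonoidHom
      (Subgroup.comap (absGaloisRestrict K _).toMonoidHom κ.kerSubgroup)
    rw [Subgroup.map_comap_eq]
    refine Subgroup.mem_inf.2 ⟨hrange, ?_⟩
    rw [show κ.kerSubgroup = _ from hκ, Subgroup.mem_comap]
    change GaloisRep.cyclotomicCharacter K 2 g ∈ CommGroup.torsion ℤ_[2]ˣ
    rw [hχ]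
    exact (CommGroup.torsion ℤ_[2]ˣ).one_mem
  -- descend
  have hrel := finite_pTorsion_fineRelaxed_of_primewise_upstairs W 2 κ hNΩ hΩ (finiteIndex_upstairs_subgroupOf' W κ hκ) hup
  obtain ⟨γ₀, hγ₀⟩ : ∃ γ₀ : absoluteGaloisGroup K, κ.IsTopGenerator γ₀ := κ.surjective (Multiplicative.ofAdd 1)
  exact (IwasawaModuleFinitePadicInt.exists_fineSelmerDualData_moduleFinite_iff_finite_pTorsion W κ hγ₀).2
    (LimRelUpstairs.finite_pTorsion_fineSelmer_of_relaxed W κ hrel)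

end PointField

/-! ## §3 `K = ℚ`: the two classical-`μ` supply roads of Q⁺, without the Lim@2 print binder -/

section Cell

/-- **Q⁺ ⟸ Iw⁺, KERNEL** (no `hLim2`): Iwasawa's `μ₂ = 0` for the cyclotomic `ℤ₂`-extensions of `ℚ(W[2], √−1)` on the cell
(`ClassicalMuTwoDivisionFieldAdjoinIOrdPosDisc`, p699544) ⟹ Coates–Sujatha's (A) at `2` on the cell (`FineSelmerConjATwoOrdPosDisc`) — the lead
g6's `fineSelmerConjATwoOrdPosDisc_of_lim_of_classicalMu` with the Lim@2 binder DISCHARGED by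
`Lim2017.thm35_at_two_upstairs_fineSelmer_twoTorsion_finite_of_classicalMuVanishes_holds` (through the cell bsd-f1-sign2 descent
`LimRelUpstairs.exists_fineSelmerDualData_moduleFinite_of_lim2017`). Iw⁺ is an OPEN classical conjecture; nothing is asserted about it.
[cite: Lim2017FineSelmer, §3 Thm. 3.5 and Lemma 3.2] [cite: CoatesSujatha2005, Conj. A] [cite: Iwasawa1973MuInvariants, §1 (shape only)] -/
theorem fineSelmerConjATwoOrdPosDisc_of_classicalMuTwo (hIw : ClassicalMuTwoDivisionFieldAdjoinIOrdPosDisc) :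
    FineSelmerConjATwoOrdPosDisc := by
  intro W _ _ hcm hr hgo h2 hΔ κ hκ
  obtain ⟨i, hi⟩ := IsAlgClosed.exists_pow_nat_eq (-1 : AlgebraicClosure ℚ) two_pos
  exact LimRelUpstairs.exists_fineSelmerDualData_moduleFinite_of_lim2017 W κ
    Lim2017.thm35_at_two_upstairs_fineSelmer_twoTorsion_finite_of_classicalMuVanishes_holds i hi
    (hIw W hcm hr hgo h2 hΔ i hi) hκ

/-- **Q⁺ from Iwasawa's `μ₂ = 0` on the SMALL carrier `ℚ(P, √−1)`, KERNEL** (no `hLim2`): for every curve of the cell SOME non-zero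
`P ∈ W[2]` and SOME `i` with `i² = −1` such that every cyclotomic `ℤ₂`-extension of `ℚ(P, i) = ℚ̄^{Stab P} ⊔ ℚ⟮i⟯` (degree `6`, totally
imaginary) has classical `μ = 0` ⟹ Q⁺. The hypothesis is VERBATIM that of the lead g7's displayed road
`conjA_two_posDisc_of_lim_of_classicalMu_pointField` (p706268 `…PosDiscSmallCarrier`), whose other binder `hLim2` (print, and at this carrier
resting on Iwasawa's 1973 ascent) is no longer needed: §2. Per curve this is TWO class groups of degree-`6·2ⁿ` fields (Fukuda) — eng-2's
GREENBERG2 i-tower census. Nothing closed; Q⁺ and the `μ₂ = 0` input remain OPEN as `∀`-statements.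
[cite: Lim2017FineSelmer, §3 Thm. 3.5 and Lemma 3.2] [cite: CoatesSujatha2005, Conj. A and Thm. 3.4] [cite: Iwasawa1973MuInvariants, §1 (shape only)] -/
theorem fineSelmerConjATwoOrdPosDisc_of_classicalMu_pointField_adjoin_I
    (hIw : ∀ (W : WeierstrassCurve ℚ) [W.IsElliptic] [W.IsGloballyMinimal], ¬ W.HasCM → W.analyticRank = 0 →
      GoodOrd W 2 → W.HasSurjectiveModNGaloisRep 2 → 0 < W.Δ →
      ∃ (P : geomTorsion W 2) (i : AlgebraicClosure ℚ), P ≠ 0 ∧ i ^ 2 = -1 ∧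
        ∀ κL : ZpExtension
            ↥(IntermediateField.fixedField (MulAction.stabilizer (absoluteGaloisGroup ℚ) P) ⊔ IntermediateField.adjoin ℚ {i}) 2,
          κL.IsCyclotomic → ClassicalMuVanishes κL) :
    FineSelmerConjATwoOrdPosDisc := by
  intro W _ _ hcm hr hgo h2 hΔ κ hκ
  obtain ⟨P, i, hP, hi, hμ⟩ := hIw W hcm hr hgo h2 hΔ
  exact exists_fineSelmerDualData_moduleFinite_of_classicalMu_pointField_adjoin W hP hi hμ κ hκ

end Cell

end Summit.BirchSwinnertonDyer.BirchSwinnertonDyer.Theorems.SteinbergFibreAtTwo.PointFieldMuInline45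

end

-- ============================== PART 2: Cert45b.lean after its imports (namespace Cert45c) ==============================

/-!
# Cert45 (GEN 45) = Cert42 (GEN 42) VERBATIM (namespace renamed) + the §GEN 45 block at the end (Lim-up KERNEL folded);
# Cert42 (GEN 42) — crux `OrdKatoHalfAtTwoIso` (stmt-BirchSwinnertonDyer-19573), line `steinberg-fibre-at-two`:
# JOINT SUFFICIENCY OF THE v19 STUB 7-TUPLE **WITHOUT Aʳ** — the crux BY NAME from
# {F1μι⁻, P⁺, Q⁺, bundle, Lim-down ∧ FW, R-opt∃♭, Greenberg L.4.6@2 ∧ Lim-up}, built ONLY from TREE-LANDED modules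
# (refuter-grade certificate; nothing asserted, nothing landed; independent of the lead's pending p711951 / p712620 / leaf C)

Seat `cruxtriage-stmt-BirchSwinnertonDyer-19573-2` (crux-triage round 1, seat 2, GEN 42). PURPOSE: the pen's RC-438 GO #2 replaces the
reserve-tier binder Aʳ (`ArchimedeanLambdaModTwoOrdAtTwo`, `…RelaxedGenuineDefs`) on the not-onto road by the PRINT fact
`Greenberg1999.lemma46_relaxed_mod_selmer_infinite_rat_two` (h46, p608868) + Kato 17.4 (1) at `2` (h17, third conjunct of PUB); the lead's
v19 registers `stub_lemma46_limUp : h46 ∧ Lim@2-upstairs` and `stub_relaxedZetaOptimal_existsMember_flat : R-opt∃♭` in place of v18's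
`stub_colemanHalfClass_optimal_off514`. This file checks, BEFORE v19 is registered and with NO unlanded import, that the seven v19 stub TYPES
(five registered v18 types verbatim + the two announced ones) GIVE THE CRUX BY NAME (§6 `ordKatoHalfAtTwoIso_of_v19_stubs`), i.e. that the
«re-glue of Cert39b §3 on (h46, hD)» is indeed one line and that `hD : D.IsTorsion` is available where the door needs it (from h17 at the
witness member's conductor-level newform — the level at which `X5.O1.KatoMuPartAtTwo` asks). It also records which print conjuncts the road
leaves IDLE (`stub_bundle.2.2` = Greenberg 5.14@2 and `stub_limFW.1` = Lim@2-downstairs are not consumed by THIS composition).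

HONEST FRAMING (cell bsd-2adic): BSD is not proved by any of this; the crux, B7, child 23921 and the pair child 24097 are NOT proved here;
every theorem below is CONDITIONAL on its displayed hypotheses (memo-tier R-opt∃♭ / F1μι⁻ / P⁺, research-tier Q⁺, print-tier facts as
hypotheses). §0 is audit-2's `ArchOfLemma46` evidence (bsd-2adic-audit-2 GEN 64, evidence #6 on 24097; = the lead's pending p712620)
re-typed in this namespace so that the certificate imports only the tree.

* §0 `module_finite_relaxedDual`, `lengthAt_selmer_add_one_le_relaxed_of_lemma46` — audit-2's lemmas (f1-sign2 kernel by name).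
* §1 R-opt∃♭ `RelaxedZetaOptimalAtTwoExistsMemberFlat` — Cert39b §1 VERBATIM (the lead's p711951 §1 = this text modulo the ORDER of the
  two conjuncts after `IsIsogenous W W₁ ∧`, bus 10:16Z; immaterial).
* §2 `katoMuPartAtTwo_of_relaxedColemanNeron_of_kato17` — Cert39b §2 with the relaxed-data hypothesis asked only for TORSION `D`
  (`D.IsTorsion →`) and only at the conductor-level newform, `hD` fed from h17 at the curve itself.
* §3 `relaxedData_of_package_of_lemma46` — Cert39b §3 re-glued on `(h46, hD)`: ONE line changes (`lengthAt_selmer_add_one_le_relaxed_of_lemma46`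
  in place of `hA … ⟩ + lengthAt_add_one_le_of_archExtension`).
* §4 `katoMuPartAtOptimalMember_of_existsMemberFlat_of_lemma46 : Lim-up → FW → R-opt∃♭ → h46 → h17 → B7 UNCUT` + child 23921 BY NAME.
* §6 the crux BY NAME: `ordKatoHalfAtTwoIso_of_existsMember_of_lemma46` (inputs hNeg, hPos, AU, Lim-up, FW, R-opt∃♭, h46, h17) and
  **`ordKatoHalfAtTwoIso_of_v19_stubs`** (inputs = the seven v19 stub types; `0 < Δ` conjunct via the (ε) door; 5.14@2 and Lim-down idle).

References: [GreenbergLNM1716] §4 Lemma 4.6 (p. 105), Remark (pp. 106–107); [Kato2004Asterisque] Thm 12.5, 12.6, 17.4, Prop 17.11, §17.13;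
[Lim2017FineSelmer] Thm 3.5; [FerreroWashington1979]; [AbbesUllmo1996] Thm A; tree p608868 (h46), p706741 (R-opt), Cert39b.md (crux dir).
-/

set_option autoImplicit false
set_option linter.dupNamespace false

noncomputable section

open scoped Classical MatrixGroups ModularForm NumberField
open CongruenceSubgroup WeierstrassCurve Field IsDedekindDomain NumberField
open Literature.NumberTheory.GaloisRepresentations
open Literature.NumberTheory.GaloisCohomology
open Literature.NumberTheory.EllipticCurves Literature.NumberTheory.EllipticCurves.ModularForms
open Literature.NumberTheory.EllipticCurves.Kato2004
  Literature.NumberTheory.EllipticCurves.Kato2004.EulerSystemValues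
open Literature.NumberTheory.EllipticCurves.Rank1Residual
open Literature.NumberTheory.EllipticCurves.Greenberg1999
open Literature.NumberTheory.IwasawaTheory
open Summit.BirchSwinnertonDyer.BirchSwinnertonDyer.Theorems.Rank1ResidualX1Defs
  Summit.BirchSwinnertonDyer.BirchSwinnertonDyer.Rank1Residual
  Summit.BirchSwinnertonDyer.BirchSwinnertonDyer.Rank1Residual.CoreAssembly
open Summit.BirchSwinnertonDyer.Rank1Residual Summit.BirchSwinnertonDyer.Rank1Residual.X5
  Summit.BirchSwinnertonDyer.Rank1Residual.X1.MuLambda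
open Summit.BirchSwinnertonDyer.BirchSwinnertonDyer.Theorems.OrdKatoOptimalAtTwo
  Summit.BirchSwinnertonDyer.BirchSwinnertonDyer.Theorems.OrdKatoIntAtTwo
open Summit.BirchSwinnertonDyer.BirchSwinnertonDyer.Theses.ByReductionTypeAtTwo
open Summit.BirchSwinnertonDyer.BirchSwinnertonDyer.Theorems.AlignedTransportAtTwoFineRoad
open Summit.BirchSwinnertonDyer.BirchSwinnertonDyer.Theorems.SteinbergFibreAtTwo

namespace Summit.BirchSwinnertonDyer.BirchSwinnertonDyer.Cruxes.OrdKatoHalfAtTwoIso.Cert45c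

/-! ## §0 audit-2's `ArchOfLemma46` lemmas (evidence #6 on 24097 = pending p712620), re-typed here so that only the TREE is imported -/

/-- **Every relaxed Selmer dual datum is finitely generated over `Λ`** (dual Nakayama; f1-sign2 `ArchReceptacle.module_finite_of_pinned`
applied to the fields of `Dr`). Unconditional. (audit-2, `ArchOfLemma46.module_finite_relaxedDual`.)
[cite: GreenbergLNM1716, §1 p. 60 (after Conj. 1.3)] -/
theorem module_finite_relaxedDual (W : WeierstrassCurve ℚ) [W.IsElliptic] (κ : ZpExtension ℚ 2) {γ : absoluteGaloisGroup ℚ}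
    (hγ : κ.IsTopGenerator γ) (Dr : W.SelmerDualDataRelaxedInf κ γ) :
    Module.Finite (IwasawaAlgebra 2) Dr.X :=
  ArchReceptacle.module_finite_of_pinned W κ hγ Dr.toDual Dr.bijective Dr.toDual_T_smul Dr.toDual_C_smul

/-- **GRANTED h46: `ℓ₍₂₎(X) + 1 ≤ ℓ₍₂₎(X^{rel ∞})`** for a TORSION strict datum `D`, any relaxed datum `Dr` and any compatible `q`
(audit-2, `ArchOfLemma46.lengthAt_selmer_add_one_le_relaxed_of_lemma46`; f1-sign2 `ArchRigidity.lengthAt_selmer_add_one_le_lengthAt_relaxed`).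
[cite: GreenbergLNM1716, §4 Lemma 4.6 (p. 105) and Remark (pp. 106–107)] -/
theorem lengthAt_selmer_add_one_le_relaxed_of_lemma46 (h46 : lemma46_relaxed_mod_selmer_infinite_rat_two)
    (W : WeierstrassCurve ℚ) [W.IsElliptic] [W.IsGloballyMinimal] (κ : ZpExtension ℚ 2) {γ : absoluteGaloisGroup ℚ}
    (hord : IsOrdinaryAt W 2) (hΔ : 0 < W.Δ) (hκ : κ.IsCyclotomic) (hγ : κ.IsTopGenerator γ)
    (D : W.SelmerDualData κ γ) (Dr : W.SelmerDualDataRelaxedInf κ γ) (hD : D.IsTorsion)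
    (q : Dr.X →ₗ[IwasawaAlgebra 2] D.X)
    (hq : ∀ (x : Dr.X) (s : W.selmerInfty κ),
      D.toDual (q x) s = Dr.toDual x (AddSubgroup.inclusion (W.selmerInfty_le_selmerInftyRelaxedInf κ) s)) :
    Module.lengthAt (IwasawaAlgebra 2) D.X ⟨IwasawaAlgebra.augIdealP 2, IwasawaAlgebra.isPrime_augIdealP_holds 2⟩ + 1 ≤
      Module.lengthAt (IwasawaAlgebra 2) Dr.X ⟨IwasawaAlgebra.augIdealP 2, IwasawaAlgebra.isPrime_augIdealP_holds 2⟩ := by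
  haveI := module_finite_relaxedDual W κ hγ Dr
  exact ArchRigidity.lengthAt_selmer_add_one_le_lengthAt_relaxed W Dr.toDual h46 hord hΔ hκ hγ D hD Dr.bijective q hq

/-! ## §1 R-opt∃♭ — Cert39b §1 VERBATIM (DISPLAYED TEXT; nothing asserted) -/

/-- [MEMO tier, OPEN — a reading, nothing asserted] **R-opt∃♭** — see Cert39b.md §1 in the crux directory for the full gloss: for every
non-CM globally minimal `W`, good ordinary at `2`, `ρ̄_{W,2}` NOT onto, an isogenous globally minimal member `W₁` carrying (a) the FLAT
relaxed-at-`∞` Coleman package in NÉRON currency at every newform / cyclotomic datum / `ϖ` / relaxed data, image clause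
`s·(2^{[0<Δ_{W₁}]}·L₀) ∈ M` for every `L₀` with `ι L₀ = ϖ·L₂(f, α_{W₁})`, and (b) clause (b) of B7 verbatim. Memo witness `W₁ := E•`.
NOT in print at `2`; nothing asserted.
[cite: Kato2004Asterisque, Thm. 12.6 (p. 222), Thm. 17.4 (1)(2) (p. 273), Prop. 17.11 (p. 277), §17.13 (pp. 279–280) (shape only; nothing asserted)]
[cite: Wuthrich2014, Prop. 8 and §2.2 (p. 388–389) (shape only)] -/
def RelaxedZetaOptimalAtTwoExistsMemberFlat : Prop :=
  ∀ (W : WeierstrassCurve ℚ) [W.IsElliptic] [W.IsGloballyMinimal],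
    ¬ W.HasCM → GoodOrd W 2 → ¬ W.HasSurjectiveModNGaloisRep 2 →
    ∃ (W₁ : WeierstrassCurve ℚ) (_ : W₁.IsElliptic) (_ : W₁.IsGloballyMinimal),
      WeierstrassCurve.IsIsogenous W W₁ ∧
      (∀ {N : ℕ} [NeZero N] (f : CuspForm (Gamma0 N) 2) (κ : ZpExtension ℚ 2) (γ : absoluteGaloisGroup ℚ),
        κ.IsCyclotomic → κ.IsTopGenerator γ → IsCyclotomicVariable 2 γ → IsNewformOf W₁ f →
        ∀ ϖ : ℚ, (ϖ : ℝ) * W₁.realPeriodRat = plusPeriod f →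
        ∀ (Dr : W₁.SelmerDualDataRelaxedInf κ γ) (Yr : W₁.FineSelmerDualDataRelaxedInf κ γ),
          ∃ (P : Submodule (IwasawaAlgebra 2) (IwasawaAlgebra 2)) (M : Submodule (IwasawaAlgebra 2) P)
            (τ : P →ₛₗ[((IwasawaAlgebra.involEquiv 2).toRingEquiv : IwasawaAlgebra 2 →+* IwasawaAlgebra 2)] Dr.X)
            (π : Dr.X →ₗ[IwasawaAlgebra 2] Yr.X),
            (∀ m ∈ M, τ m = 0) ∧ Function.Surjective π ∧ Function.Exact τ π ∧
            ∀ L₀ : IwasawaAlgebra 2,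
              iwasawaToPowerSeries 2 L₀ =
                  PowerSeries.C (ϖ : ℚ_[2]) * padicLFunction f (unitRoot W₁ 2 : ℚ_[2]) →
                ∃ s : IwasawaAlgebra 2, s ∉ IwasawaAlgebra.augIdealP 2 ∧
                  s * (PowerSeries.C (((2 : ℕ) : ℤ_[2]) ^ (if 0 < W₁.Δ then 1 else 0)) * L₀) ∈
                    Submodule.map P.subtype M) ∧
      ∀ [NeZero (W₁.conductorNorm ℤ)] (f : CuspForm (Gamma0 (W₁.conductorNorm ℤ)) 2),
        IsNewformOf W₁ f → ∀ ϖ : ℚ, (ϖ : ℝ) * W₁.realPeriodRat = plusPeriod f →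
          ∃ L₀ : IwasawaAlgebra 2, iwasawaToPowerSeries 2 L₀ =
            PowerSeries.C (ϖ : ℚ_[2]) * padicLFunction f (unitRoot W₁ 2 : ℚ_[2])

/-! ## §2 The one-curve slack door in NÉRON currency, relaxed data asked for TORSION `D` only (fed by Kato 17.4 (1) at `2`) -/

/-- **`X5.O1.KatoMuPartAtTwo W′` at ONE curve** from (i) relaxed data booked at `2^e·L₀` for every TORSION strict datum `D` at the
conductor-level newform (archimedean clause `ℓ₍₂₎(X) + e ≤ ℓ₍₂₎(Xr)`, image clause for every `L₀` with `ι L₀ = ϖ·L₂(f, α)`),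
(ii) relaxed (A₂) «`ℓ₍₂₎(X₀^{rel}) = 0`», (iii) Kato 17.4 (1)(2) at `2` at `W′` (supplies `D.IsTorsion`). Cert39b §2 otherwise verbatim
(`mu_le_mu_of_relaxedColemanSemilinear_of_arch` at `G := L₀`). [cite: Kato2004Asterisque, Thm. 17.4 (1) (p. 273), §17.13 (pp. 279–280)]
[cite: GreenbergLNM1716, §4 Lemma 4.6 (PDF pp. 106–107)] -/
theorem katoMuPartAtTwo_of_relaxedColemanNeron_of_kato17 (W' : WeierstrassCurve ℚ) [W'.IsElliptic] [W'.IsGloballyMinimal]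
    (hR : ∀ [NeZero (W'.conductorNorm ℤ)] (f : CuspForm (Gamma0 (W'.conductorNorm ℤ)) 2) (κ : ZpExtension ℚ 2)
      (γ : absoluteGaloisGroup ℚ),
      κ.IsCyclotomic → κ.IsTopGenerator γ → IsCyclotomicVariable 2 γ → IsNewformOf W' f →
      ∀ ϖ : ℚ, (ϖ : ℝ) * W'.realPeriodRat = plusPeriod f →
      ∀ (D : W'.SelmerDualData κ γ) (Yr : W'.FineSelmerDualDataRelaxedInf κ γ), D.IsTorsion →
        ∃ (Xr : Type) (_ : AddCommGroup Xr) (_ : Module (IwasawaAlgebra 2) Xr)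
          (θ : IwasawaAlgebra 2 ≃+* IwasawaAlgebra 2) (P : Submodule (IwasawaAlgebra 2) (IwasawaAlgebra 2))
          (M : Submodule (IwasawaAlgebra 2) P)
          (τ : P →ₛₗ[(θ : IwasawaAlgebra 2 →+* IwasawaAlgebra 2)] Xr) (π : Xr →ₗ[IwasawaAlgebra 2] Yr.X) (e : ℕ),
          (∀ m ∈ M, τ m = 0) ∧ Function.Surjective π ∧ Function.Exact τ π ∧
          Module.lengthAt (IwasawaAlgebra 2) D.X
              ⟨IwasawaAlgebra.augIdealP 2, IwasawaAlgebra.isPrime_augIdealP_holds 2⟩ + e ≤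
            Module.lengthAt (IwasawaAlgebra 2) Xr ⟨IwasawaAlgebra.augIdealP 2, IwasawaAlgebra.isPrime_augIdealP_holds 2⟩ ∧
          ∀ L₀ : IwasawaAlgebra 2,
            iwasawaToPowerSeries 2 L₀ = PowerSeries.C (ϖ : ℚ_[2]) * padicLFunction f (unitRoot W' 2 : ℚ_[2]) →
              ∃ s : IwasawaAlgebra 2, s ∉ IwasawaAlgebra.augIdealP 2 ∧
                s * (PowerSeries.C (((2 : ℕ) : ℤ_[2]) ^ e) * L₀) ∈ Submodule.map P.subtype M)
    (hAr : ∀ (κ : ZpExtension ℚ 2) (γ : absoluteGaloisGroup ℚ), κ.IsCyclotomic → κ.IsTopGenerator γ →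
      ∀ Yr : W'.FineSelmerDualDataRelaxedInf κ γ,
        Module.lengthAt (IwasawaAlgebra 2) Yr.X ⟨IwasawaAlgebra.augIdealP 2, IwasawaAlgebra.isPrime_augIdealP_holds 2⟩ = 0)
    (h17W : ∀ [NeZero (W'.conductorNorm ℤ)] (f : CuspForm (Gamma0 (W'.conductorNorm ℤ)) 2),
      kato_divisibility_allPrimes W' 2 (f := f)) :
    O1.KatoMuPartAtTwo W' := by
  intro κ γ hκ hγ hγ' hord _ f hf ϖ hϖf D L₀ hL₀
  have hD : D.IsTorsion := (h17W f κ γ hκ hγ hγ' hord hf D).1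
  obtain ⟨Yr⟩ := W'.nonempty_fineSelmerDualDataRelaxedInf κ hγ
  obtain ⟨Xr, _, _, θ, P, M, τ, π, e, hτM, -, hπ, harch, himg⟩ := hR f κ γ hκ hγ hγ' hf ϖ hϖf D Yr hD
  by_cases hL0 : L₀ = 0
  · rw [hL0]; exact dvd_zero _
  have hμ : D.mu ≤ mu L₀ :=
    mu_le_mu_of_relaxedColemanSemilinear_of_arch (D := D) hL0 θ P M τ π hτM hπ (himg L₀ hL₀) harch (hAr κ γ hκ hγ Yr)
  calc (PowerSeries.C (((2 : ℕ) : ℤ_[2]) ^ D.mu) : IwasawaAlgebra 2)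
      ∣ PowerSeries.C (((2 : ℕ) : ℤ_[2]) ^ mu L₀) := map_dvd _ (pow_dvd_pow _ hμ)
    _ ∣ L₀ := C_pow_mu_dvd hL0

/-! ## §3 Relaxed data at ONE good-ordinary curve from a package with an arbitrary image predicate — RE-GLUED ON (h46, hD) -/

/-- **The relaxed data of the door at ONE good-ordinary curve `V` for a TORSION strict datum `D`, from a package whose image clause is keyed
to an arbitrary predicate `Φ` on `Λ`, plus Greenberg's Lemma 4.6 at `2` (h46, PRINT)** — Cert39b §3 with `hA` (Aʳ) replaced by `(h46, hD)`:
on `0 < Δ_V` the archimedean clause `ℓ₍₂₎(X) + 1 ≤ ℓ₍₂₎(X^{rel})` is §0's `lengthAt_selmer_add_one_le_relaxed_of_lemma46`; on `Δ_V < 0`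
(`e = 0`) it is the surjectivity of `q`. ONE line differs from Cert39b §3. [cite: GreenbergLNM1716, §4 Lemma 4.6 (p. 105) and Remark (pp. 106–107)] -/
theorem relaxedData_of_package_of_lemma46 (h46 : lemma46_relaxed_mod_selmer_infinite_rat_two)
    (V : WeierstrassCurve ℚ) [V.IsElliptic] [V.IsGloballyMinimal] (hord : IsOrdinaryAt V 2)
    (Φ : IwasawaAlgebra 2 → Prop) {κ : ZpExtension ℚ 2} {γ : absoluteGaloisGroup ℚ} (hκ : κ.IsCyclotomic)
    (hγ : κ.IsTopGenerator γ) (D : V.SelmerDualData κ γ) (hD : D.IsTorsion) (Yr : V.FineSelmerDualDataRelaxedInf κ γ)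
    (hpack : ∀ Dr : V.SelmerDualDataRelaxedInf κ γ,
      ∃ (P : Submodule (IwasawaAlgebra 2) (IwasawaAlgebra 2)) (M : Submodule (IwasawaAlgebra 2) P)
        (τ : P →ₛₗ[((IwasawaAlgebra.involEquiv 2).toRingEquiv : IwasawaAlgebra 2 →+* IwasawaAlgebra 2)] Dr.X)
        (π : Dr.X →ₗ[IwasawaAlgebra 2] Yr.X),
        (∀ m ∈ M, τ m = 0) ∧ Function.Surjective π ∧ Function.Exact τ π ∧
        ∀ L₀ : IwasawaAlgebra 2, Φ L₀ →
          ∃ s : IwasawaAlgebra 2, s ∉ IwasawaAlgebra.augIdealP 2 ∧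
            s * (PowerSeries.C (((2 : ℕ) : ℤ_[2]) ^ (if 0 < V.Δ then 1 else 0)) * L₀) ∈ Submodule.map P.subtype M) :
    ∃ (Xr : Type) (_ : AddCommGroup Xr) (_ : Module (IwasawaAlgebra 2) Xr)
      (θ : IwasawaAlgebra 2 ≃+* IwasawaAlgebra 2) (P : Submodule (IwasawaAlgebra 2) (IwasawaAlgebra 2))
      (M : Submodule (IwasawaAlgebra 2) P)
      (τ : P →ₛₗ[(θ : IwasawaAlgebra 2 →+* IwasawaAlgebra 2)] Xr) (π : Xr →ₗ[IwasawaAlgebra 2] Yr.X) (e : ℕ),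
      (∀ m ∈ M, τ m = 0) ∧ Function.Surjective π ∧ Function.Exact τ π ∧
      Module.lengthAt (IwasawaAlgebra 2) D.X
          ⟨IwasawaAlgebra.augIdealP 2, IwasawaAlgebra.isPrime_augIdealP_holds 2⟩ + e ≤
        Module.lengthAt (IwasawaAlgebra 2) Xr ⟨IwasawaAlgebra.augIdealP 2, IwasawaAlgebra.isPrime_augIdealP_holds 2⟩ ∧
      ∀ L₀ : IwasawaAlgebra 2, Φ L₀ →
        ∃ s : IwasawaAlgebra 2, s ∉ IwasawaAlgebra.augIdealP 2 ∧
          s * (PowerSeries.C (((2 : ℕ) : ℤ_[2]) ^ e) * L₀) ∈ Submodule.map P.subtype M := by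
  let Dr : V.SelmerDualDataRelaxedInf κ γ := V.selmerDualDataRelaxedInf κ hγ
  obtain ⟨q, hq⟩ := exists_relaxedSelmerRestrict V κ hγ Dr D
  have hqs := relaxedSelmerRestrict_surjective V κ Dr D q hq
  obtain ⟨P, M, τ, π, hτM, hπs, hπ, himg⟩ := hpack Dr
  refine ⟨Dr.X, inferInstance, inferInstance, (IwasawaAlgebra.involEquiv 2).toRingEquiv, P, M, τ, π,
    (if 0 < V.Δ then 1 else 0), hτM, hπs, hπ, ?_, himg⟩
  by_cases hΔ : 0 < V.Δ
  · rw [if_pos hΔ, Nat.cast_one]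
    exact lengthAt_selmer_add_one_le_relaxed_of_lemma46 h46 V κ hord hΔ hκ hγ D Dr hD q hq
  · rw [if_neg hΔ, Nat.cast_zero, add_zero]
    exact Module.lengthAt_le_of_surjective q hqs _

/-! ## §4 B7 UNCUT and the child 23921 BY NAME from R-opt∃♭ + h46 + h17 + Lim@2 upstairs + Ferrero–Washington -/

/-- **B7 UNCUT `KatoMuPartAtOptimalMemberOfNotSurjectiveTwo` BY NAME ⟸ Lim 2017 Thm 3.5 at `2` UPSTAIRS (print) + Ferrero–Washington
(print) + R-opt∃♭ (memo) + Greenberg L.4.6 at `2` (h46, print) + Kato 17.4 (1)(2) at `2` (h17, print; only (1) = cotorsion is used here).**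
NO Aʳ, NO Abbes–Ullmo, NO modularity, NO Greenberg 5.14@2. Witness member `W₁` and clause (b) from R-opt∃♭; clause (a) at `W₁` = §2 over §3
with relaxed (A₂) at `W₁` (`not_hasSurjectiveModNGaloisRep_two_of_isIsogenous` + Lim-up + FW). CONDITIONAL; nothing closed.
[cite: Lim2017FineSelmer, §3 Thm. 3.5 and Lemma 3.2] [cite: FerreroWashington1979, Theorem] [cite: GreenbergLNM1716, §4 Lemma 4.6 (p. 105)]
[cite: Kato2004Asterisque, Thm. 17.4 (1) (p. 273)] -/
theorem katoMuPartAtOptimalMember_of_existsMemberFlat_of_lemma46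
    (hLim : Lim2017.thm35_at_two_upstairs_fineSelmer_twoTorsion_finite_of_classicalMuVanishes)
    (hFW : ferreroWashington1979_classicalMuVanishes)
    (hR : RelaxedZetaOptimalAtTwoExistsMemberFlat) (h46 : lemma46_relaxed_mod_selmer_infinite_rat_two)
    (h17 : ∀ (V : WeierstrassCurve ℚ) [V.IsElliptic] [V.IsGloballyMinimal] [NeZero (V.conductorNorm ℤ)]
      (f : CuspForm (Gamma0 (V.conductorNorm ℤ)) 2), kato_divisibility_allPrimes V 2 (f := f)) :
    KatoMuPartAtOptimalMemberOfNotSurjectiveTwo := by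
  intro W _ _ hcm hgo hns
  obtain ⟨W₁, _, _, hiso, hpack, hint⟩ := hR W hcm hgo hns
  have hgo₁ : GoodOrd W₁ 2 := goodOrd_two_of_isIsogenous W hiso hgo
  have hns₁ : ¬ W₁.HasSurjectiveModNGaloisRep 2 := not_hasSurjectiveModNGaloisRep_two_of_isIsogenous W hns hiso
  refine ⟨W₁, ‹_›, ‹_›, hiso, ?_, hint⟩
  refine katoMuPartAtTwo_of_relaxedColemanNeron_of_kato17 W₁ (fun f κ γ hκ hγ hγ' hf ϖ hϖ D Yr hD ↦ ?_)
    (fun κ γ hκ hγ Yr ↦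
      lengthAt_fineRelaxed_eq_zero_of_not_hasSurjectiveModNGaloisRep_of_limUpstairs_of_FW hLim hFW W₁ hns₁ hκ hγ Yr)
    (fun f ↦ h17 W₁ f)
  exact relaxedData_of_package_of_lemma46 h46 W₁ ⟨hgo₁.1, hgo₁.2⟩
    (fun L₀ ↦ iwasawaToPowerSeries 2 L₀ = PowerSeries.C (ϖ : ℚ_[2]) * padicLFunction f (unitRoot W₁ 2 : ℚ_[2]))
    hκ hγ D hD Yr (fun Dr ↦ hpack f κ γ hκ hγ hγ' hf ϖ hϖ Dr Yr)

/-- **The route's child `OrdKatoMuPartOptimalAtTwo` (stmt-BirchSwinnertonDyer-23921, text = B7′ verbatim) BY NAME** from the same five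
inputs (B7 ⇒ B7′, `katoMuPartOff514_of_katoMuPartAtOptimalMember`, p679274). CONDITIONAL; the item is NOT closed by this.
[cite: Lim2017FineSelmer, §3 Thm. 3.5] [cite: FerreroWashington1979, Theorem] [cite: GreenbergLNM1716, §4 Lemma 4.6 (p. 105)] -/
theorem ordKatoMuPartOptimalAtTwo_of_existsMemberFlat_of_lemma46
    (hLim : Lim2017.thm35_at_two_upstairs_fineSelmer_twoTorsion_finite_of_classicalMuVanishes)
    (hFW : ferreroWashington1979_classicalMuVanishes)
    (hR : RelaxedZetaOptimalAtTwoExistsMemberFlat) (h46 : lemma46_relaxed_mod_selmer_infinite_rat_two)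
    (h17 : ∀ (V : WeierstrassCurve ℚ) [V.IsElliptic] [V.IsGloballyMinimal] [NeZero (V.conductorNorm ℤ)]
      (f : CuspForm (Gamma0 (V.conductorNorm ℤ)) 2), kato_divisibility_allPrimes V 2 (f := f)) :
    OrdKatoMuPartOptimalAtTwo :=
  katoMuPartOff514_of_katoMuPartAtOptimalMember (katoMuPartAtOptimalMember_of_existsMemberFlat_of_lemma46 hLim hFW hR h46 h17)

/-! ## §6 The crux BY NAME — WITHOUT Aʳ -/

/-- **The crux `OrdKatoHalfAtTwoIso` (stmt-BirchSwinnertonDyer-19573) BY NAME from F1μι⁻ (memo), the direct `0 < Δ` child (by name),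
Abbes–Ullmo, Lim@2 upstairs, Ferrero–Washington, R-opt∃♭, Greenberg L.4.6 at `2` and Kato 17.4 (1)(2) at `2`** —
`ordKatoHalfAtTwoIso_of_iota_halves_B7` with B7 := §4. NO Aʳ, NO Greenberg 5.14@2, NO modularity on the not-onto road. CONDITIONAL; the crux
is NOT closed by this. [cite: Kato2004Asterisque, Thm. 17.4 (1)(2) (p. 273)] [cite: AbbesUllmo1996, Thm. A] [cite: GreenbergLNM1716, §4 Lemma 4.6 (p. 105)] -/
theorem ordKatoHalfAtTwoIso_of_existsMember_of_lemma46 (hNeg : ZetaColemanMuIotaNegDiscAtTwo) (hPos : OrdKatoHalfAtTwoIsoPosDisc)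
    (hAU : abbesUllmo_not_dvd_maninConstant_of_not_dvd_level)
    (hLim : Lim2017.thm35_at_two_upstairs_fineSelmer_twoTorsion_finite_of_classicalMuVanishes)
    (hFW : ferreroWashington1979_classicalMuVanishes)
    (hR : RelaxedZetaOptimalAtTwoExistsMemberFlat) (h46 : lemma46_relaxed_mod_selmer_infinite_rat_two)
    (h17 : ∀ (V : WeierstrassCurve ℚ) [V.IsElliptic] [V.IsGloballyMinimal] [NeZero (V.conductorNorm ℤ)]
      (f : CuspForm (Gamma0 (V.conductorNorm ℤ)) 2), kato_divisibility_allPrimes V 2 (f := f)) :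
    OrdKatoHalfAtTwoIso :=
  ordKatoHalfAtTwoIso_of_iota_halves_B7 hNeg hPos hAU
    (katoMuPartAtOptimalMember_of_existsMemberFlat_of_lemma46 hLim hFW hR h46 h17) h17

/-- **JOINT SUFFICIENCY OF THE v19 STUB 7-TUPLE (types only; no stub NAME of the unregistered skeleton is used)**: the crux BY NAME from
`s1 : ZetaColemanMuIotaNegDiscAtTwo` (F1μι⁻, memo) · `s2 : ColemanMuSpanFreeIotaPosDiscAtTwo` (P⁺, memo) · `s3 : FineSelmerConjATwoOrdPosDisc`
(Q⁺, research) · `s4 : PUB ∧ Abbes–Ullmo ∧ Greenberg 5.14@2` (bundle, print; = child 23889 verbatim) · `s5 : Lim@2-downstairs ∧ Ferrero–Washington`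
(print) · `s6 : R-opt∃♭` (memo-exact 394/394) · `s7 : Greenberg L.4.6@2 ∧ Lim@2-upstairs` (print ×2). Composition: the `0 < Δ` conjunct by the
(ε) door `ordKatoHalfAtTwoIsoPosDisc_of_epsilon s2 s3 AU h17`, B7 UNCUT by §4, the crux by `ordKatoHalfAtTwoIso_of_iota_halves_B7`.
IDLE on this road: `s4.2.2` (Greenberg 5.14@2) and `s5.1` (Lim@2-downstairs) — discarded below (`-`). CONDITIONAL; the crux is NOT closed.
[cite: Kato2004Asterisque, Thm. 17.4 (1)(2) (p. 273)] [cite: AbbesUllmo1996, Thm. A] [cite: GreenbergLNM1716, §4 Lemma 4.6 (p. 105)]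
[cite: Lim2017FineSelmer, §3 Thm. 3.5 and Lemma 3.2] [cite: FerreroWashington1979, Theorem] -/
theorem ordKatoHalfAtTwoIso_of_v19_stubs (s1 : ZetaColemanMuIotaNegDiscAtTwo) (s2 : ColemanMuSpanFreeIotaPosDiscAtTwo)
    (s3 : FineSelmerConjATwoOrdPosDisc)
    (s4 : Literature.Uncategorized.OrdPublishedInputsAtTwo ∧ abbesUllmo_not_dvd_maninConstant_of_not_dvd_level ∧
      Literature.NumberTheory.EllipticCurves.Greenberg1999.prop514_isTorsion_mu_eq_zero_two)
    (s5 : Lim2017.thm35_at_two_fineSelmerDual_moduleFinite_of_classicalMuVanishes_of_le_divisionField_four ∧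
      Literature.NumberTheory.IwasawaTheory.ferreroWashington1979_classicalMuVanishes)
    (s6 : RelaxedZetaOptimalAtTwoExistsMemberFlat)
    (s7 : Greenberg1999.lemma46_relaxed_mod_selmer_infinite_rat_two ∧
      Lim2017.thm35_at_two_upstairs_fineSelmer_twoTorsion_finite_of_classicalMuVanishes) :
    Summit.BirchSwinnertonDyer.BirchSwinnertonDyer.Theses.ByReductionTypeAtTwo.OrdKatoHalfAtTwoIso := by
  obtain ⟨hPub, hAU, -⟩ := s4
  obtain ⟨-, hFW⟩ := s5
  obtain ⟨h46, hLim⟩ := s7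
  have h17 : ∀ (V : WeierstrassCurve ℚ) [V.IsElliptic] [V.IsGloballyMinimal] [NeZero (V.conductorNorm ℤ)]
      (f : CuspForm (Gamma0 (V.conductorNorm ℤ)) 2), kato_divisibility_allPrimes V 2 (f := f) := by
    obtain ⟨_, _, h17, _⟩ := hPub
    exact h17
  exact ordKatoHalfAtTwoIso_of_iota_halves_B7 s1 (ordKatoHalfAtTwoIsoPosDisc_of_epsilon s2 s3 hAU h17) hAU
    (katoMuPartAtOptimalMember_of_existsMemberFlat_of_lemma46 hLim hFW s6 h46 h17) h17

/-- **The PAIR child `OrdKatoFineZetaAtTwoResidue` (stmt-BirchSwinnertonDyer-24097) BY NAME over the same types** (unchanged from v16/v18: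
F1μι⁻, P⁺, Q⁺, Abbes–Ullmo, h17 — the (ε) door; neither R-opt∃♭ nor h46 enters). Sanity that the v19 re-cut does not touch 24097's cone.
[cite: Kato2004Asterisque, Thm. 17.4 (1)(2) (p. 273), §17.13 (pp. 279–280)] -/
theorem pair_of_v19_stubs (s1 : ZetaColemanMuIotaNegDiscAtTwo) (s2 : ColemanMuSpanFreeIotaPosDiscAtTwo)
    (s3 : FineSelmerConjATwoOrdPosDisc)
    (s4 : Literature.Uncategorized.OrdPublishedInputsAtTwo ∧ abbesUllmo_not_dvd_maninConstant_of_not_dvd_level ∧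
      Literature.NumberTheory.EllipticCurves.Greenberg1999.prop514_isTorsion_mu_eq_zero_two) :
    OrdKatoFineZetaAtTwoResidue := by
  obtain ⟨hPub, hAU, -⟩ := s4
  have h17 : ∀ (V : WeierstrassCurve ℚ) [V.IsElliptic] [V.IsGloballyMinimal] [NeZero (V.conductorNorm ℤ)]
      (f : CuspForm (Gamma0 (V.conductorNorm ℤ)) 2), kato_divisibility_allPrimes V 2 (f := f) := by
    obtain ⟨_, _, h17, _⟩ := hPub
    exact h17
  exact ordKatoFineZetaAtTwoResidue_of_negDisc_of_epsilon s1 s2 s3 hAU h17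

/-! ## GEN 45 (crux-triage seat 2, 2026-08-29): the Lim-up conjunct is now a KERNEL theorem (w2 GEN 6, p716773
`Lim2017.thm35_at_two_upstairs_fineSelmer_twoTorsion_finite_of_classicalMuVanishes_holds`). Consequences BY NAME for the v19 7-tuple:
(a) `s7` may be registered as h46 ALONE; (b) the HONEST INPUT LIST of the picked line after 2026-08-29T11:5xZ is
memo {F1μι⁻, P⁺, R-opt∃♭} · research {Q⁺} · print {Kato 17.4 (1)(2)@2 (= the only conjunct of PUB used), Abbes–Ullmo, Ferrero–Washington, Greenberg L.4.6@2};
IDLE: Greenberg 5.14@2, Lim@2-downstairs, the rest of PUB. Refuter-grade certificate; nothing asserted, nothing landed; the crux is NOT closed. -/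

/-- **v19 with the seventh stub folded to h46 ALONE** (pen RC-455 folding word): the crux BY NAME from the six other stub types and
`h46 : Greenberg1999.lemma46_relaxed_mod_selmer_infinite_rat_two`, the Lim-up conjunct being supplied by the KERNEL theorem `…_holds`.
CONDITIONAL; the crux is NOT closed by this. [cite: GreenbergLNM1716, §4 Lemma 4.6 (p. 105)] [cite: Lim2017FineSelmer, §3 Thm. 3.5] -/
theorem ordKatoHalfAtTwoIso_of_v19_stubs_h46 (s1 : ZetaColemanMuIotaNegDiscAtTwo) (s2 : ColemanMuSpanFreeIotaPosDiscAtTwo)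
    (s3 : FineSelmerConjATwoOrdPosDisc)
    (s4 : Literature.Uncategorized.OrdPublishedInputsAtTwo ∧ abbesUllmo_not_dvd_maninConstant_of_not_dvd_level ∧
      Literature.NumberTheory.EllipticCurves.Greenberg1999.prop514_isTorsion_mu_eq_zero_two)
    (s5 : Lim2017.thm35_at_two_fineSelmerDual_moduleFinite_of_classicalMuVanishes_of_le_divisionField_four ∧
      Literature.NumberTheory.IwasawaTheory.ferreroWashington1979_classicalMuVanishes)
    (s6 : RelaxedZetaOptimalAtTwoExistsMemberFlat)
    (h46 : Greenberg1999.lemma46_relaxed_mod_selmer_infinite_rat_two) :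
    Summit.BirchSwinnertonDyer.BirchSwinnertonDyer.Theses.ByReductionTypeAtTwo.OrdKatoHalfAtTwoIso :=
  ordKatoHalfAtTwoIso_of_v19_stubs s1 s2 s3 s4 s5 s6
    ⟨h46, Lim2017.thm35_at_two_upstairs_fineSelmer_twoTorsion_finite_of_classicalMuVanishes_holds⟩

/-- **MINIMAL HONEST INPUT LIST of the picked line (GEN 45)**: the crux BY NAME from the three memo texts, the research text Q⁺, and
FOUR print facts — Kato 17.4 (1)(2) at `2` (`h17`, the only conjunct of `OrdPublishedInputsAtTwo` this road consumes), Abbes–Ullmo, Ferrero–Washington,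
Greenberg L.4.6 at `2` — Lim@2-upstairs entering as the KERNEL theorem. No Aʳ, no Greenberg 5.14@2, no Lim@2-downstairs, no other PUB conjunct.
CONDITIONAL; the crux is NOT closed by this. [cite: Kato2004Asterisque, Thm. 17.4 (1)(2) (p. 273)] [cite: AbbesUllmo1996, Thm. A]
[cite: FerreroWashington1979, Theorem] [cite: GreenbergLNM1716, §4 Lemma 4.6 (p. 105)] -/
theorem ordKatoHalfAtTwoIso_of_minimal_inputs (s1 : ZetaColemanMuIotaNegDiscAtTwo) (s2 : ColemanMuSpanFreeIotaPosDiscAtTwo)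
    (s3 : FineSelmerConjATwoOrdPosDisc) (s6 : RelaxedZetaOptimalAtTwoExistsMemberFlat)
    (h17 : ∀ (V : WeierstrassCurve ℚ) [V.IsElliptic] [V.IsGloballyMinimal] [NeZero (V.conductorNorm ℤ)]
      (f : CuspForm (Gamma0 (V.conductorNorm ℤ)) 2), kato_divisibility_allPrimes V 2 (f := f))
    (hAU : abbesUllmo_not_dvd_maninConstant_of_not_dvd_level)
    (hFW : Literature.NumberTheory.IwasawaTheory.ferreroWashington1979_classicalMuVanishes)
    (h46 : Greenberg1999.lemma46_relaxed_mod_selmer_infinite_rat_two) :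
    Summit.BirchSwinnertonDyer.BirchSwinnertonDyer.Theses.ByReductionTypeAtTwo.OrdKatoHalfAtTwoIso :=
  ordKatoHalfAtTwoIso_of_iota_halves_B7 s1 (ordKatoHalfAtTwoIsoPosDisc_of_epsilon s2 s3 hAU h17) hAU
    (katoMuPartAtOptimalMember_of_existsMemberFlat_of_lemma46
      Lim2017.thm35_at_two_upstairs_fineSelmer_twoTorsion_finite_of_classicalMuVanishes_holds hFW s6 h46 h17) h17


/-! ## GEN 45b (crux-triage r1 seat 2, 2026-08-29 ≈12:25Z): the research text Q⁺ behind the two KERNEL classical-`μ` doors landed by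
w2 GEN 6 (`…Theorems.ByReductionTypeAtTwoOrdKatoHalfAtTwoIsoConjATwoOfPointFieldMu`, tree mtime 12:15:46Z): Q⁺ ⟸ Iw⁺ (carrier `ℚ(W[2], √−1)`)
and Q⁺ ⟸ Iw₆⁺ (carrier the sextic point field `ℚ(P, √−1)`, `P ∈ W[2] ∖ 0`), both BY NAME, no Lim@2 print binder. Consequence certified
below: the picked line's ONLY research-grade input can be taken to be Iwasawa's classical `μ₂ = 0` for the cyclotomic `ℤ₂`-extension of the
`S₃`-sextic CM field `ℚ(P, √−1)` over the `0 < Δ`, `ρ̄₂`-onto, rank-0, good-ordinary-at-2 cell — an OPEN classical conjecture on a NON-ABELIAN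
family (Ferrero–Washington / Sinnott do not apply); per class it is two class-group computations (Fukuda), cf. eng-2's GREENBERG2 census.
Refuter-grade certificate; CONDITIONAL; nothing asserted; the crux, Q⁺, Iw⁺, Iw₆⁺ all remain OPEN; BSD is not proved. -/

section Doors

open Literature.NumberTheory.EllipticCurves.GreenbergSelmer
open Summit.BirchSwinnertonDyer.BirchSwinnertonDyer.Theorems.SteinbergFibreAtTwo.PointFieldMuInline45

/-- Door 1 BY NAME: Iw⁺ → Q⁺ (w2 GEN 6, kernel). [cite: Lim2017FineSelmer, §3 Thm. 3.5 and Lemma 3.2] -/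
theorem door_Iw_to_Q (hIw : ClassicalMuTwoDivisionFieldAdjoinIOrdPosDisc) : FineSelmerConjATwoOrdPosDisc :=
  fineSelmerConjATwoOrdPosDisc_of_classicalMuTwo hIw

/-- The sextic-point-field hypothesis Iw₆⁺, copied VERBATIM from the binder of
`PointFieldMu.fineSelmerConjATwoOrdPosDisc_of_classicalMu_pointField_adjoin_I` and named here only for this certificate (scratch name,
not a tree definition). [cite: Iwasawa1973MuInvariants, §1 (the conjecture μ = 0; shape only)] -/
def ClassicalMuTwoPointFieldAdjoinIOrdPosDisc : Prop :=
  ∀ (W : WeierstrassCurve ℚ) [W.IsElliptic] [W.IsGloballyMinimal], ¬ W.HasCM → W.analyticRank = 0 →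
      GoodOrd W 2 → W.HasSurjectiveModNGaloisRep 2 → 0 < W.Δ →
      ∃ (P : geomTorsion W 2) (i : AlgebraicClosure ℚ), P ≠ 0 ∧ i ^ 2 = -1 ∧
        ∀ κL : ZpExtension
            ↥(IntermediateField.fixedField (MulAction.stabilizer (absoluteGaloisGroup ℚ) P) ⊔ IntermediateField.adjoin ℚ {i}) 2,
          κL.IsCyclotomic → ClassicalMuVanishes κL

/-- Door 2 BY NAME: Iw₆⁺ → Q⁺ (w2 GEN 6, kernel; the lead g7's `conjA_two_posDisc_of_lim_of_classicalMu_pointField` minus `hLim2`).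
[cite: Lim2017FineSelmer, §3 Thm. 3.5 and Lemma 3.2] [cite: CoatesSujatha2005, Conj. A and Thm. 3.4] -/
theorem door_Iw6_to_Q (hIw6 : ClassicalMuTwoPointFieldAdjoinIOrdPosDisc) : FineSelmerConjATwoOrdPosDisc :=
  fineSelmerConjATwoOrdPosDisc_of_classicalMu_pointField_adjoin_I hIw6

/-- **MINIMAL HONEST INPUT LIST, sextic form (GEN 45b)**: the crux BY NAME from the three memo texts (F1μι⁻, P⁺, R-opt∃♭), the classical
conjecture Iw₆⁺ (`μ₂ = 0` for the cyclotomic `ℤ₂`-extension of `ℚ(P, √−1)` on the cell) in place of Q⁺, and the four print facts Kato 17.4 (1)(2)@2,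
Abbes–Ullmo, Ferrero–Washington, Greenberg L.4.6@2. CONDITIONAL; the crux is NOT closed by this.
[cite: Kato2004Asterisque, Thm. 17.4 (1)(2) (p. 273)] [cite: AbbesUllmo1996, Thm. A] [cite: FerreroWashington1979, Theorem]
[cite: GreenbergLNM1716, §4 Lemma 4.6 (p. 105)] [cite: Iwasawa1973MuInvariants, §1] -/
theorem ordKatoHalfAtTwoIso_of_minimal_inputs_pointFieldMu (s1 : ZetaColemanMuIotaNegDiscAtTwo) (s2 : ColemanMuSpanFreeIotaPosDiscAtTwo)
    (s6 : RelaxedZetaOptimalAtTwoExistsMemberFlat) (hIw6 : ClassicalMuTwoPointFieldAdjoinIOrdPosDisc)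
    (h17 : ∀ (V : WeierstrassCurve ℚ) [V.IsElliptic] [V.IsGloballyMinimal] [NeZero (V.conductorNorm ℤ)]
      (f : CuspForm (Gamma0 (V.conductorNorm ℤ)) 2), kato_divisibility_allPrimes V 2 (f := f))
    (hAU : abbesUllmo_not_dvd_maninConstant_of_not_dvd_level)
    (hFW : Literature.NumberTheory.IwasawaTheory.ferreroWashington1979_classicalMuVanishes)
    (h46 : Greenberg1999.lemma46_relaxed_mod_selmer_infinite_rat_two) :
    Summit.BirchSwinnertonDyer.BirchSwinnertonDyer.Theses.ByReductionTypeAtTwo.OrdKatoHalfAtTwoIso :=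
  ordKatoHalfAtTwoIso_of_minimal_inputs s1 s2 (door_Iw6_to_Q hIw6) s6 h17 hAU hFW h46

/-- The same with Iw⁺ (carrier `ℚ(W[2], √−1)`, the route's registered text `ClassicalMuTwoDivisionFieldAdjoinIOrdPosDisc`) in place of Q⁺.
CONDITIONAL; the crux is NOT closed by this. [cite: Iwasawa1973MuInvariants, §1] [cite: Lim2017FineSelmer, §3 Thm. 3.5] -/
theorem ordKatoHalfAtTwoIso_of_minimal_inputs_Iw (s1 : ZetaColemanMuIotaNegDiscAtTwo) (s2 : ColemanMuSpanFreeIotaPosDiscAtTwo)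
    (s6 : RelaxedZetaOptimalAtTwoExistsMemberFlat) (hIw : ClassicalMuTwoDivisionFieldAdjoinIOrdPosDisc)
    (h17 : ∀ (V : WeierstrassCurve ℚ) [V.IsElliptic] [V.IsGloballyMinimal] [NeZero (V.conductorNorm ℤ)]
      (f : CuspForm (Gamma0 (V.conductorNorm ℤ)) 2), kato_divisibility_allPrimes V 2 (f := f))
    (hAU : abbesUllmo_not_dvd_maninConstant_of_not_dvd_level)
    (hFW : Literature.NumberTheory.IwasawaTheory.ferreroWashington1979_classicalMuVanishes)
    (h46 : Greenberg1999.lemma46_relaxed_mod_selmer_infinite_rat_two) :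
    Summit.BirchSwinnertonDyer.BirchSwinnertonDyer.Theses.ByReductionTypeAtTwo.OrdKatoHalfAtTwoIso :=
  ordKatoHalfAtTwoIso_of_minimal_inputs s1 s2 (door_Iw_to_Q hIw) s6 h17 hAU hFW h46

#print axioms door_Iw_to_Q
#print axioms door_Iw6_to_Q
#print axioms ordKatoHalfAtTwoIso_of_minimal_inputs_pointFieldMu

end Doors

end Summit.BirchSwinnertonDyer.BirchSwinnertonDyer.Cruxes.OrdKatoHalfAtTwoIso.Cert45c

end
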